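import Summits.AtomisticToContinuum.FouriersLaw.Theses.JunctionLocality
import Literature.MathematicalPhysics.KineticTheory.LangevinChainGibbs

/-!
# `ConductanceLowerBound` / Negative: the bath-free member `γ = 0`

Negative knowledge for crux `stmt-AtomisticToContinuum-11749`
(`JunctionLocality.ConductanceLowerBound`) and its uniqueness antecedent (`NessUnique`,
stmt-AtomisticToContinuum-0741), crux-disprover generation 2 (2026-08-15).

With the Langevin baths switched off (`γ = 0`) the weak steady-state class
`OscillatorChain.IsSteadyState` of `pinnedChain ω₂ lam β 0` is large: the Dirac mass at the
mechanical equilibrium `(q, p) = (0, 0)` and EVERY Gibbs measure `Z⁻¹ e^{-H/T}` (`T > 0`) solve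
`∫ L f dμ = 0` for ALL nominal bath temperatures.  Hence weak-NESS uniqueness FAILS at `γ = 0`
(`pinnedChain_not_unique_gamma_zero`): the hypothesis `0 < γ` of `NessUnique` is necessary, and
every crux carrying uniqueness as an antecedent (11749, 11748, 9127, 11750, 0717) is VACUOUSLY
true at `γ = 0`; while the currentless Dirac family shows that WITHOUT the uniqueness antecedent
the lower bound `liminf_N D_N > 0` is false at `γ = 0` (`conductanceLowerBound_false_without_baths_or_uniqueness`).
All statements are about the Literature model `pinnedChain`; nothing here closes an item.
-/

noncomputable section

namespace Summit.AtomisticToContinuum.FouriersLaw.Theorems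

open MeasureTheory Filter Topology
open Literature.MathematicalPhysics.KineticTheory.HeatConduction

/-- The potential energy of `pinnedChain` is even in the configuration. [folklore] -/
theorem pinnedChain_potential_neg (ω₂ lam β γ : ℝ) (N : ℕ) (q : Fin N → ℝ) :
    (pinnedChain ω₂ lam β γ).potential N (-q) = (pinnedChain ω₂ lam β γ).potential N q := by
  simp only [OscillatorChain.potential, pinnedChain, Pi.neg_apply]
  congr 1
  · exact Finset.sum_congr rfl fun i _ => by ring
  · refine Finset.sum_congr rfl fun i _ => Finset.sum_congr rfl fun j _ => ?_
    split_ifs <;> ring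

/-- `update 0 i (-t) = -(update 0 i t)`. [folklore] -/
theorem update_zero_neg {N : ℕ} (i : Fin N) (t : ℝ) :
    Function.update (0 : Fin N → ℝ) i (-t) = -Function.update (0 : Fin N → ℝ) i t := by
  funext k
  by_cases h : k = i
  · subst h; simp
  · simp [Function.update_of_ne h]

/-- At the mechanical equilibrium all forces of `pinnedChain` vanish: `∂_{q_i} H (0, 0) = 0`
(the potential is even along each coordinate line through the origin). [folklore] -/
theorem pinnedChain_partialQ_hamiltonian_origin (ω₂ lam β γ : ℝ) {N : ℕ} (i : Fin N) :
    partialQ i ((pinnedChain ω₂ lam β γ).hamiltonian N) 0 = 0 := by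
  rw [OscillatorChain.partialQ_hamiltonian_eq]
  change deriv (fun t => (pinnedChain ω₂ lam β γ).potential N
    (Function.update (0 : Fin N → ℝ) i t)) 0 = 0
  set g : ℝ → ℝ := fun t => (pinnedChain ω₂ lam β γ).potential N
    (Function.update (0 : Fin N → ℝ) i t) with hg
  have heven : (fun t => g (-t)) = g := by
    funext t
    simp only [hg, update_zero_neg, pinnedChain_potential_neg]
  have h : deriv (fun t => g (-t)) 0 = -deriv g (-0) := deriv_comp_neg g 0
  rw [heven, neg_zero] at h
  linarith

/-- `γ = 0`: the generator annihilates every observable at the origin, `(L f)(0, 0) = 0`,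
for all nominal bath temperatures. [folklore] -/
theorem pinnedChain_generator_origin_gamma_zero (ω₂ lam β : ℝ) (N : ℕ) (T_L T_R : ℝ)
    (f : PhaseSpace N → ℝ) :
    (pinnedChain ω₂ lam β 0).generator N T_L T_R f 0 = 0 := by
  have hγ : (pinnedChain ω₂ lam β 0).γ = 0 := rfl
  simp [OscillatorChain.generator, hγ, pinnedChain_partialQ_hamiltonian_origin]

/-- **`γ = 0`: the Dirac mass at the mechanical equilibrium is a weak steady state** of
`pinnedChain ω₂ lam β 0` for every `N` and all nominal bath temperatures ("the isolated system
… has many invariant states", Bonetto–Lebowitz–Rey-Bellet 2000 §5.1). [folklore] -/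
theorem pinnedChain_isSteadyState_dirac_origin (ω₂ lam β : ℝ) (N : ℕ) (T_L T_R : ℝ) :
    (pinnedChain ω₂ lam β 0).IsSteadyState N T_L T_R (Measure.dirac 0) := by
  refine ⟨inferInstance, fun f _ _ => ?_, fun i => ?_⟩
  · rw [integral_dirac]
    exact pinnedChain_generator_origin_gamma_zero ω₂ lam β N T_L T_R f
  · have h : (pinnedChain ω₂ lam β 0).bondCurrent N i =ᵐ[Measure.dirac (0 : PhaseSpace N)]
        Function.const (PhaseSpace N) ((pinnedChain ω₂ lam β 0).bondCurrent N i 0) :=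
      ae_eq_dirac _
    exact (integrable_const ((pinnedChain ω₂ lam β 0).bondCurrent N i 0)).congr h.symm

/-- The Dirac mass at the origin carries no current (any parameters). [folklore] -/
theorem pinnedChain_totalCurrent_dirac_origin (ω₂ lam β γ : ℝ) (N : ℕ) :
    (pinnedChain ω₂ lam β γ).totalCurrent (Measure.dirac (0 : PhaseSpace N)) = 0 := by
  simp [OscillatorChain.totalCurrent, integral_dirac, OscillatorChain.bondCurrent]

/-- **`γ = 0`: the Gibbs measure at ANY temperature `T > 0` is a weak steady state for ALL
nominal bath temperatures** — the bath terms of `∫ L_{T_L,T_R} f dμ_T` carry the factor `γ`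
(`pinnedChain_integral_generator_gibbsMeasure`, Cuneo–Eckmann–Hairer–Rey-Bellet 2018 §3.1).
[folklore] -/
theorem pinnedChain_isSteadyState_gibbs_gamma_zero {ω₂ lam β : ℝ} (hω : 0 < ω₂) (hl : 0 ≤ lam)
    (hβ : 0 ≤ β) (N : ℕ) {T : ℝ} (hT : 0 < T) (T_L T_R : ℝ) :
    (pinnedChain ω₂ lam β 0).IsSteadyState N T_L T_R ((pinnedChain ω₂ lam β 0).gibbsMeasure N T) := by
  refine ⟨pinnedChain_isProbabilityMeasure_gibbsMeasure hω hl hβ 0 N hT, fun f hf hfc => ?_,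
    fun i => ?_⟩
  · rw [pinnedChain_integral_generator_gibbsMeasure ω₂ lam β 0 N T T_L T_R (hf.of_le (by norm_cast))
      hfc]
    have hγ : (pinnedChain ω₂ lam β 0).γ = 0 := rfl
    simp [hγ]
  · exact (pinnedChain ω₂ lam β 0).integrable_gibbsMeasure
      (pinnedChain_integrable_bondCurrent_mul_gibbsDensity hω hl hβ 0 N hT i)

/-- The Gibbs measure of a chain with at least one site does not charge the origin. [folklore] -/
theorem pinnedChain_gibbsMeasure_origin (ω₂ lam β γ : ℝ) (N : ℕ) (T : ℝ) :
    (pinnedChain ω₂ lam β γ).gibbsMeasure (N + 1) T {0} = 0 := by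
  apply (pinnedChain ω₂ lam β γ).gibbsMeasure_absolutelyContinuous (N + 1) T
  have : NullSingletonClass (volume : Measure (PhaseSpace (N + 1))) := by
    change NullSingletonClass (Measure.prod volume volume)
    infer_instance
  exact measure_singleton 0

/-- **Weak-NESS uniqueness fails without baths.** For `pinnedChain ω₂ lam β 0` (`ω₂ > 0`,
`lam, β ≥ 0`) the body of `NessUnique` is false: at `N = 1`, `T_L = T_R = 1` the Dirac mass at
the origin and the Gibbs measure at `T = 1` are distinct weak steady states.  So `0 < γ` is a
necessary hypothesis of item 0741, and every item with uniqueness as an antecedent is vacuous at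
`γ = 0`. [folklore] -/
theorem pinnedChain_not_unique_gamma_zero {ω₂ lam β : ℝ} (hω : 0 < ω₂) (hl : 0 ≤ lam)
    (hβ : 0 ≤ β) :
    ¬ ∀ (N : ℕ) (T_L T_R : ℝ), 0 < T_L → 0 < T_R → ∀ μ ν : Measure (PhaseSpace N),
      (pinnedChain ω₂ lam β 0).IsSteadyState N T_L T_R μ →
        (pinnedChain ω₂ lam β 0).IsSteadyState N T_L T_R ν → μ = ν := by
  intro h
  have key := h 1 1 1 one_pos one_pos _ _ (pinnedChain_isSteadyState_dirac_origin ω₂ lam β 1 1 1)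
    (pinnedChain_isSteadyState_gibbs_gamma_zero hω hl hβ 1 one_pos 1 1)
  have h1 : (Measure.dirac (0 : PhaseSpace 1)) {0} = 1 := by simp
  rw [key, pinnedChain_gibbsMeasure_origin ω₂ lam β 0 0 1] at h1
  exact zero_ne_one h1

/-- **`0 < γ` cannot be dropped from `NessUnique`**: the `γ`-unrestricted version of the
uniqueness item is false (witness `γ = 0`, `pinnedChain_not_unique_gamma_zero`). [folklore] -/
theorem nessUnique_false_without_baths :
    ¬ ∀ ω₂ lam β γ : ℝ, 0 < ω₂ → 0 < lam → 0 < β →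
      ∀ (N : ℕ) (T_L T_R : ℝ), 0 < T_L → 0 < T_R → ∀ μ ν : Measure (PhaseSpace N),
        (pinnedChain ω₂ lam β γ).IsSteadyState N T_L T_R μ →
          (pinnedChain ω₂ lam β γ).IsSteadyState N T_L T_R ν → μ = ν :=
  fun h => pinnedChain_not_unique_gamma_zero (ω₂ := 1) (lam := 1) (β := 1) one_pos zero_le_one
    zero_le_one (h 1 1 1 0 one_pos one_pos one_pos)

/-- **Without baths AND without the uniqueness antecedent the conductance lower bound is false**:
the variant of `ConductanceLowerBound` with the uniqueness hypothesis dropped and `0 < γ`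
weakened to `0 ≤ γ` fails at `γ = 0` along the currentless Dirac family (`D ≡ 0`).  ("No baths,
no heat current": a proof of the crux must use `γ > 0`, and can only do so through the
uniqueness antecedent, `pinnedChain_not_unique_gamma_zero`.) [folklore] -/
theorem conductanceLowerBound_false_without_baths_or_uniqueness :
    ¬ ∀ ω₂ lam β γ : ℝ, 0 < ω₂ → 0 < lam → 0 < β → 0 ≤ γ →
      ∀ μ : (N : ℕ) → ℝ → ℝ → Measure (PhaseSpace N),
        (∀ (N : ℕ) (T_L T_R : ℝ), 0 < T_L → 0 < T_R →
          (pinnedChain ω₂ lam β γ).IsSteadyState N T_L T_R (μ N T_L T_R)) →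
        ∀ T : ℝ, 0 < T → ∀ D : ℕ → ℝ,
          (∀ N : ℕ, Tendsto (fun δ : ℝ =>
            (pinnedChain ω₂ lam β γ).totalCurrent (μ N (T + δ / 2) (T - δ / 2)) / δ)
            (𝓝[≠] 0) (𝓝 (D N))) →
          ∃ c : ℝ, 0 < c ∧ ∃ N₁ : ℕ, ∀ N : ℕ, N₁ ≤ N → c ≤ D N := by
  intro h
  have hresp : ∀ N : ℕ, Tendsto (fun δ : ℝ => (pinnedChain 1 1 1 0).totalCurrent
      ((fun (N : ℕ) (_ _ : ℝ) => Measure.dirac (0 : PhaseSpace N)) N (1 + δ / 2) (1 - δ / 2)) / δ)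
      (𝓝[≠] 0) (𝓝 ((fun _ : ℕ => (0 : ℝ)) N)) := by
    intro N
    simp only [pinnedChain_totalCurrent_dirac_origin, zero_div]
    exact tendsto_const_nhds
  obtain ⟨c, hc, N₁, hN₁⟩ := h 1 1 1 0 one_pos one_pos one_pos le_rfl
    (fun N _ _ => Measure.dirac 0)
    (fun N T_L T_R _ _ => pinnedChain_isSteadyState_dirac_origin 1 1 1 N T_L T_R)
    1 one_pos (fun _ => 0) hresp
  have := hN₁ N₁ le_rfl
  linarith

end Summit.AtomisticToContinuum.FouriersLaw.Theorems

end
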